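import Literature.NumberTheory.LFunctions.MauduitRivatWindowCount
import Mathlib.Analysis.SpecialFunctions.Pow.Real
import HarnessLib

/-!
# The smoothing error averaged over a hyperbolic box: a boundary-layer count (proved)

Everything in this file is PROVED. In our discrete replacement of the smoothing step (64) of
C. Mauduit, J. Rivat, J. Eur. Math. Soc. 17 (2015), §6 (`MauduitRivatSmoothedIndicator.lean`:
`∑_{u₀} |𝟙[r_{μ₀,μ₂}(x) = u₀] − A_{u₀}(x)| ≤ 2 min(1, K/(H T(x)))` with
`T(x) = min(x mod L, L−1−(x mod L)) + 1`, `L = k^{μ₀}`), the error terms `E₄` of (64)–(69)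
become the average of `min(1, K/(H T(mn + c)))` over the box of `(m, n)`. Instead of the
printed Fourier treatment (§6.1–6.2, via the majorant `B_{α,H}` and the sums (22)), we bound it
by COUNTING the `(m, n)` whose product lies within `W` of the block grid `Lℤ`
(`MauduitRivatWindowCount.card_window_le`) and using `K/(HT) ≤ K/(HW)` elsewhere:

* `sum_box_min_le` — for `1 ≤ W ≤ L`, `M₀ ≥ 1`, `X ≥ 0`,
  `∑_{M₀≤m<M₁, N₀≤n<N₀+N} min(1, X/T(mn+c))
     ≤ 2(M₁−M₀)(NW/L + W + 2) + 8 τ(L) M₁ N/L + (X/W)(M₁−M₀)N`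
  (with `X = K/H = L k^{−2ρ}` and `W = L k^{−ρ}` both error terms save `k^{−ρ}`).

## References
* C. Mauduit, J. Rivat, J. Eur. Math. Soc. 17 (2015), §6.1–6.2 ((64)–(70)). [MauduitRivat2015]
-/

noncomputable section

open Finset

namespace Literature.NumberTheory.LFunctions.MauduitRivat

/-- The distance-to-the-grid parameter `T(x) = min(x mod L, L − 1 − (x mod L)) + 1`. [folklore] -/
def gridDist (L x : ℕ) : ℕ := min (x % L) (L - 1 - x % L) + 1

/-- Unfolding. [folklore] -/
theorem gridDist_apply (L x : ℕ) : gridDist L x = min (x % L) (L - 1 - x % L) + 1 := rfl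

/-- `T(x) ≥ 1`. [folklore] -/
theorem one_le_gridDist (L x : ℕ) : 1 ≤ gridDist L x := Nat.le_add_left _ _

/-- If `T(x) ≤ W` then `x mod L` lies in `[0, W)` or in `[L − W, L)`. [folklore] -/
theorem window_of_gridDist_le {L W x : ℕ} (hL : 0 < L) (h : gridDist L x ≤ W) :
    ∃ a ∈ ({0, L - W} : Finset ℕ), a ≤ x % L ∧ x % L < a + W := by
  rw [gridDist_apply] at h
  have hx : x % L < L := Nat.mod_lt _ hL
  rcases le_total (x % L) (L - 1 - x % L) with h1 | h1
  · rw [min_eq_left h1] at h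
    exact ⟨0, by simp, Nat.zero_le _, by omega⟩
  · rw [min_eq_right h1] at h
    exact ⟨L - W, by simp, by omega, by omega⟩

/-- **The boundary-layer count**: pairs `(m, n)` in the box with `T(mn + c) ≤ W` number at most
`2 ∑_m (N gcd(m,L)/L + 1)(W/gcd(m,L) + 2)`. [cite: MauduitRivat2015, §6.1 (replacement)] -/
theorem card_box_gridDist_le_sum {L : ℕ} (hL : 0 < L) (W c M₀ M₁ N₀ N : ℕ) :
    (((Ico M₀ M₁) ×ˢ (Ico N₀ (N₀ + N))).filter
        (fun p : ℕ × ℕ => gridDist L (p.1 * p.2 + c) ≤ W)).card ≤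
      2 * ∑ m ∈ Ico M₀ M₁, (N * Nat.gcd m L / L + 1) * (W / Nat.gcd m L + 2) := by
  rw [card_filter, sum_product, mul_sum]
  refine sum_le_sum fun m _ => ?_
  rw [← card_filter]
  calc ((Ico N₀ (N₀ + N)).filter (fun n => gridDist L (m * n + c) ≤ W)).card
      ≤ ((Ico N₀ (N₀ + N)).filter (fun n => ∃ a ∈ ({0, L - W} : Finset ℕ),
          a ≤ (m * n + c) % L ∧ (m * n + c) % L < a + W)).card := by
        refine card_le_card fun n hn => ?_
        rw [mem_filter] at hn ⊢
        exact ⟨hn.1, window_of_gridDist_le hL hn.2⟩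
    _ ≤ ({0, L - W} : Finset ℕ).card * (N * Nat.gcd m L / L + 1) * (W / Nat.gcd m L + 2) :=
        card_window_le hL c N₀ N W _
    _ ≤ 2 * ((N * Nat.gcd m L / L + 1) * (W / Nat.gcd m L + 2)) := by
        rw [mul_assoc]
        exact Nat.mul_le_mul_right _ card_le_two

/-- The same in real numbers with the gcd's summed (`M₀ ≥ 1`):
`#{T(mn+c) ≤ W} ≤ 2(M₁−M₀)(NW/L + W + 2) + 8 τ(L) M₁ N/L`. [cite: MauduitRivat2015, §6.1 (replacement)] -/
theorem card_box_gridDist_le {L : ℕ} (hL : 0 < L) (W c : ℕ) {M₀ M₁ : ℕ} (hM₀ : 1 ≤ M₀)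
    (N₀ N : ℕ) :
    ((((Ico M₀ M₁) ×ˢ (Ico N₀ (N₀ + N))).filter
        (fun p : ℕ × ℕ => gridDist L (p.1 * p.2 + c) ≤ W)).card : ℝ) ≤
      2 * ((M₁ - M₀ : ℕ) : ℝ) * ((N : ℝ) * W / L + W + 2) +
        8 * (L.divisors.card : ℝ) * M₁ * N / L := by
  have hLR : (0 : ℝ) < L := by exact_mod_cast hL
  have h1 := card_box_gridDist_le_sum hL W c M₀ M₁ N₀ N
  have h1R : ((((Ico M₀ M₁) ×ˢ (Ico N₀ (N₀ + N))).filter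
      (fun p : ℕ × ℕ => gridDist L (p.1 * p.2 + c) ≤ W)).card : ℝ) ≤
      2 * ∑ m ∈ Ico M₀ M₁, ((((N * Nat.gcd m L / L + 1) * (W / Nat.gcd m L + 2)) : ℕ) : ℝ) := by
    exact_mod_cast h1
  refine h1R.trans ?_
  have hterm : ∀ m ∈ Ico M₀ M₁,
      ((((N * Nat.gcd m L / L + 1) * (W / Nat.gcd m L + 2)) : ℕ) : ℝ) ≤
        ((N : ℝ) * W / L + W + 2) + 2 * N * (Nat.gcd m L : ℝ) / L := by
    intro m _
    set d := Nat.gcd m L with hd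
    have hd0 : 0 < d := Nat.gcd_pos_of_pos_right _ hL
    have hdR : (0 : ℝ) < d := by exact_mod_cast hd0
    have hA : ((N * d / L : ℕ) : ℝ) ≤ (N : ℝ) * d / L := by
      rw [le_div_iff₀ hLR]; exact_mod_cast Nat.div_mul_le_self (N * d) L
    have hB : ((W / d : ℕ) : ℝ) ≤ (W : ℝ) / d := by
      rw [le_div_iff₀ hdR]; exact_mod_cast Nat.div_mul_le_self W d
    have hB' : ((W / d : ℕ) : ℝ) ≤ (W : ℝ) := by exact_mod_cast Nat.div_le_self _ _
    have hcast : ((((N * d / L + 1) * (W / d + 2)) : ℕ) : ℝ) =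
        (((N * d / L : ℕ) : ℝ) + 1) * (((W / d : ℕ) : ℝ) + 2) := by
      push_cast; ring
    rw [hcast]
    calc (((N * d / L : ℕ) : ℝ) + 1) * (((W / d : ℕ) : ℝ) + 2)
        = ((N * d / L : ℕ) : ℝ) * ((W / d : ℕ) : ℝ) + 2 * ((N * d / L : ℕ) : ℝ) +
            (((W / d : ℕ) : ℝ) + 2) := by ring
      _ ≤ ((N : ℝ) * d / L) * ((W : ℝ) / d) + 2 * ((N : ℝ) * d / L) + ((W : ℝ) + 2) := by
          gcongr
      _ = ((N : ℝ) * W / L + W + 2) + 2 * N * (d : ℝ) / L := by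
          field_simp
          ring
  calc 2 * ∑ m ∈ Ico M₀ M₁, ((((N * Nat.gcd m L / L + 1) * (W / Nat.gcd m L + 2)) : ℕ) : ℝ)
      ≤ 2 * ∑ m ∈ Ico M₀ M₁, (((N : ℝ) * W / L + W + 2) + 2 * N * (Nat.gcd m L : ℝ) / L) :=
        mul_le_mul_of_nonneg_left (sum_le_sum hterm) (by norm_num)
    _ = 2 * (((M₁ - M₀ : ℕ) : ℝ) * ((N : ℝ) * W / L + W + 2) +
          2 * N / L * ∑ m ∈ Ico M₀ M₁, (Nat.gcd m L : ℝ)) := by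
        rw [sum_add_distrib, sum_const, Nat.card_Ico, nsmul_eq_mul, mul_sum]
        congr 2
        exact sum_congr rfl fun m _ => by ring
    _ ≤ 2 * (((M₁ - M₀ : ℕ) : ℝ) * ((N : ℝ) * W / L + W + 2) +
          2 * N / L * (2 * (L.divisors.card : ℝ) * M₁)) := by
        gcongr
        exact_mod_cast sum_Ico_gcd_le (M₁ := M₁) hM₀ hL
    _ = _ := by ring

/-- **The smoothing error on average over the box** (replacing MR §6.1–6.2): for `1 ≤ W`,
`M₀ ≥ 1`, `X ≥ 0`,
`∑_{m,n} min(1, X/T(mn+c)) ≤ 2(M₁−M₀)(NW/L + W + 2) + 8 τ(L) M₁ N/L + (X/W)(M₁−M₀)N`.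
[cite: MauduitRivat2015, (64)–(70) (replacement)] -/
theorem sum_box_min_le {L : ℕ} (hL : 0 < L) {X : ℝ} (hX : 0 ≤ X) {W : ℕ} (hW : 1 ≤ W) (c : ℕ)
    {M₀ M₁ : ℕ} (hM₀ : 1 ≤ M₀) (N₀ N : ℕ) :
    ∑ p ∈ (Ico M₀ M₁) ×ˢ (Ico N₀ (N₀ + N)), min 1 (X / (gridDist L (p.1 * p.2 + c) : ℝ)) ≤
      2 * ((M₁ - M₀ : ℕ) : ℝ) * ((N : ℝ) * W / L + W + 2) + 8 * (L.divisors.card : ℝ) * M₁ * N / L +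
        X / W * (((M₁ - M₀ : ℕ) : ℝ) * N) := by
  have hWR : (0 : ℝ) < W := by exact_mod_cast hW
  set box := (Ico M₀ M₁) ×ˢ (Ico N₀ (N₀ + N)) with hbox
  set P : ℕ × ℕ → Prop := fun p => gridDist L (p.1 * p.2 + c) ≤ W with hP
  rw [← sum_filter_add_sum_filter_not box P]
  refine add_le_add ?_ ?_
  · -- near the grid: each term is at most `1`
    calc ∑ p ∈ box.filter P, min 1 (X / (gridDist L (p.1 * p.2 + c) : ℝ))
        ≤ ∑ _p ∈ box.filter P, (1 : ℝ) := sum_le_sum fun p _ => min_le_left _ _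
      _ = ((box.filter P).card : ℝ) := by rw [sum_const, nsmul_eq_mul, mul_one]
      _ ≤ _ := card_box_gridDist_le hL W c hM₀ N₀ N
  · -- away from the grid: each term is at most `X / W`
    calc ∑ p ∈ box.filter (fun p => ¬ P p), min 1 (X / (gridDist L (p.1 * p.2 + c) : ℝ))
        ≤ ∑ _p ∈ box.filter (fun p => ¬ P p), X / W := by
          refine sum_le_sum fun p hp => (min_le_right _ _).trans ?_
          rw [mem_filter] at hp
          have hT : (W : ℝ) ≤ gridDist L (p.1 * p.2 + c) := by
            have : W < gridDist L (p.1 * p.2 + c) := lt_of_not_ge hp.2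
            exact_mod_cast this.le
          exact div_le_div_of_nonneg_left hX hWR hT
      _ = ((box.filter (fun p => ¬ P p)).card : ℝ) * (X / W) := by rw [sum_const, nsmul_eq_mul]
      _ ≤ (box.card : ℝ) * (X / W) := by
          have hc : ((box.filter (fun p => ¬ P p)).card : ℝ) ≤ box.card := by
            exact_mod_cast card_le_card (filter_subset _ _)
          exact mul_le_mul_of_nonneg_right hc (by positivity)
      _ = X / W * (((M₁ - M₀ : ℕ) : ℝ) * N) := by
          rw [hbox, card_product, Nat.card_Ico, Nat.card_Ico, Nat.add_sub_cancel_left]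
          push_cast; ring

end Literature.NumberTheory.LFunctions.MauduitRivat
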